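import Summits.BirchSwinnertonDyer.BirchSwinnertonDyer.Theorems.Rank2Observatory2DescClRealCurveCertSDefs
import Summits.BirchSwinnertonDyer.BirchSwinnertonDyer.Theorems.Rank2Observatory2DescClSubCurveCertSDefs
import HarnessLib

/-!
# BirchSwinnertonDyer — rank ≥ 2 observatory: KERNEL-2DESC-CL v3.0rks — the TOTALLY REAL split-2 kill-list certificate with the SUBGROUP SIEVE, part 1/2: the checker

HONEST FRAMING: per-curve certified theorems and census instruments; no claim on BSD in rank ≥ 2.

Part 1 of 2.  The totally real twin of `Rank2Observatory2DescClSubCurveCertSDefs` (v3.0ks): `checkRSKS G ccr r ks sv` =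
the clauses of the totally real split-2 checker `checkRS G ccr r` (`Rank2Observatory2DescClRealCurveCertSDefs`)
VERBATIM except its final count, followed by the kill-list clauses of v3.0k / v3.0ks read on the underlying
signature-free records `G.toS2`, `ccr.cc`: every raw kill `(U, p, fuel) : ClKillS` is light (`ClKillS.lite`), every
class passing the sieve `admRSK G ccr ks` — `admRS` AND none of the killed classes (`TwoDescCubic.admKills`) — is
listed in `sv`, and the subgroup-sieve search `noSubB` of `Rank2Observatory2DescClSubgroupSieve` succeeds at depth
`r + 1` over the live classes.  ONE layer serves single kills (eight admissible classes: `ks = [k]`) and kill sets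
(sixteen: `c₁, c₂, c₁c₂`).  The residue searches `killSearchS G.toS2 ccr.cc ks` stay a separate hypothesis.
Soundness (`rank_le_of_checkRSKS`) is part 2.

New declarations only; nothing landed or staged is touched.  Sorry-free; axioms `propext`, `Classical.choice`,
`Quot.sound`.

[cite: Cassels1991LecturesEllipticCurves, §15] [cite: CremonaAlgorithms1997, §3.6]
-/

set_option linter.dupNamespace false

noncomputable section

open scoped Classical NumberField nonZeroDivisors

open Literature.NumberTheory.NumberFields Polynomial Module NumberField IsDedekindDomain Ideal

namespace Summit.BirchSwinnertonDyer.BirchSwinnertonDyer.Rank2Observatory.TwoDescCl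

open TwoDescCubic ClFieldCert TwoDescKill

section Checkers

variable (G : ClFieldCertRS2) (ccr : ClCurveCertSR)

/-- **The totally real sieve with killed classes excluded**: `admRS G ccr` and none of the listed classes
(`TwoDescCubic.admKills` over the kill entries of the underlying split-2 records). [folklore] -/
def admRSK (ks : List ClKillS) : Finset (Fin 0) → Finset (Fin (famS ccr.cc).length) → Bool :=
  admKills (admRS G ccr) (killEntriesS G.toS2 ccr.cc ks)

/-- The LIVE classes of a totally real row: the listed classes `sv` that pass `admRSK`. [folklore] -/
def liveRSKS (ks : List ClKillS) (sv : List (List ℕ)) : List (Finset (Fin (famS ccr.cc).length)) :=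
  (sv.map (survClsS ccr.cc)).filter fun V => admRSK G ccr ks ∅ V

/-- **The totally real split-2 per-curve `r`-checker with a kill list and the SUBGROUP SIEVE**: the clauses of
`checkRS G ccr r` except its count, verbatim; then the light kill clauses, the completeness of the survivor list
`sv` for the sieve `admRSK`, and the `noSubB` search of depth `r + 1` over the live classes.  Computable; run by
`decide +kernel`. [cite: Cassels1991LecturesEllipticCurves, §15] [cite: CremonaAlgorithms1997, §3.6] -/
def checkRSKS (r : ℕ) (ks : List ClKillS) (sv : List (List ℕ)) : Bool :=
  decide (deltaShort ccr.cc.A ccr.cc.B ccr.cc.C ≠ 0) &&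
    noRootMod ccr.cc.pF ccr.cc.A ccr.cc.B ccr.cc.C &&
    decide (cubicAtCoords G.toS2.fs.base.a G.toS2.fs.base.b G.toS2.fs.base.c ((G.toS2.m₁ : ℤ) * ccr.cc.A)
      ((G.toS2.m₁ : ℤ) ^ 2 * ccr.cc.B) ((G.toS2.m₁ : ℤ) ^ 3 * ccr.cc.C) ccr.cc.Xt = (0, 0, 0)) &&
    decide (derivAtCoords G.toS2.fs.base.a G.toS2.fs.base.b G.toS2.fs.base.c ((G.toS2.m₁ : ℤ) * ccr.cc.A)
      ((G.toS2.m₁ : ℤ) ^ 2 * ccr.cc.B) ccr.cc.Xt =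
      MonicCubic.mulCoords G.toS2.fs.base.a G.toS2.fs.base.b G.toS2.fs.base.c
        (smulCoords (G.toS2.m₁ : ℤ) ccr.cc.XD)
        (prodPowCoords G.toS2.fs.base.a G.toS2.fs.base.b G.toS2.fs.base.c [])) &&
    (fracOf G.toS2 ccr.cc.Xt ccr.cc.tsnT).check G.toS2.fs.base.a G.toS2.fs.base.b G.toS2.fs.base.c &&
    (fracOf G.toS2 ccr.cc.XD ccr.cc.tsnD).check G.toS2.fs.base.a G.toS2.fs.base.b G.toS2.fs.base.c &&
    decide (0 < MonicCubic.disc ccr.cc.A ccr.cc.B ccr.cc.C) &&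
    decide (normFormZ G.toS2.fs.base.a G.toS2.fs.base.b G.toS2.fs.base.c ccr.cc.XD.1 ccr.cc.XD.2.1
      ccr.cc.XD.2.2 ≠ 0) &&
    decide ((normFormZ G.toS2.fs.base.a G.toS2.fs.base.b G.toS2.fs.base.c ccr.cc.XD.1 ccr.cc.XD.2.1
      ccr.cc.XD.2.2).natAbs = (ccr.cc.dn.map fun pe => pe.1 ^ pe.2).prod) &&
    (ccr.cc.dn.all fun pe => primeDispatchS G.toS2 ccr.cc (fracOf G.toS2 ccr.cc.XD ccr.cc.tsnD) ccr.cc.XD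
      ccr.cc.dinvA ccr.cc.dmiss2 pe.1) &&
    (ccr.cc.codes.all fun bc => codeClauseS G.toS2 ccr.cc bc) &&
    invCert G.toS2.fs.base.a G.toS2.fs.base.b G.toS2.fs.base.c G.toS2.fs.base.w₁ ccr.cc.XD ccr.cc.dW1 &&
    invCert G.toS2.fs.base.a G.toS2.fs.base.b G.toS2.fs.base.c G.toS2.fs.base.w₂ ccr.cc.XD ccr.cc.dW2 &&
    (ccr.cc.Q.all fun q => decide (0 < q)) &&
    decide (ccr.cc.head.length = 5) &&
    ((famS ccr.cc).all fun f => famCheckSR G ccr f) &&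
    (linLtCond (G.fr.I ccr.o₀).1 (G.fr.I ccr.o₀).2 (G.fr.I ccr.o₁).1 (G.fr.I ccr.o₁).2 ccr.cc.Xt &&
      linLtCond (G.fr.I ccr.o₁).1 (G.fr.I ccr.o₁).2 (G.fr.I ccr.o₂).1 (G.fr.I ccr.o₂).2 ccr.cc.Xt) &&
    decide (∀ T : Finset (Fin (famS ccr.cc).length), T ≠ ∅ →
      ∃ k : Fin (G.toS2.fs.base.chars.length + 5), Odd (T.filter fun j => bitRS G ccr k j = true).card) &&
    (ks.all fun k => k.lite G.toS2 ccr.cc) &&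
    decide (∀ U : Finset (Fin (famS ccr.cc).length), admRSK G ccr ks ∅ U = true → U ∈ sv.map (survClsS ccr.cc)) &&
    noSubB (fun U => decide (U ∈ liveRSKS G ccr ks sv)) (liveRSKS G ccr ks sv) (r + 1) [∅]

end Checkers

end Summit.BirchSwinnertonDyer.BirchSwinnertonDyer.Rank2Observatory.TwoDescCl

end
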